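import Mathlib
import HarnessLib

/-!
# A line-graded recognition lemma: two representations of a Lie algebra in which a grading element has a LINE as top eigenspace
# and the raising root space is full admit a non-zero intertwiner of the derived algebra (Goursat graphs between unitary Lie algebras `𝔲(m,1)`)

Topic `Literature/Algebra/Lie`.  Theorems only (no definition, no named fact), Mathlib vocabulary (`LieRing`, `LieAlgebra`, `LieAlgebra.ad`,
`Module.End`, `Module.Dual`, `LinearMap.smulRight`).  Written for the cell `pub-hodgecm2` (COR-CM), seat `b27` gen 52 (count-neutral
Mumford–Tate-rank ladder: the exact value of `dim MT(H¹(T × T′))` for two simple complex abelian threefolds of type IV(2,1) — a «unitary analogue»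
of Moonen–Zarhin's Lemma (3.4) on Goursat graphs `𝔰𝔩₂ → 𝔰𝔩₂`, here for graphs `𝔰𝔲(W₁) → 𝔰𝔲(W₂)` between the eigenspaces `W_i` of the imaginary
quadratic multiplications, detected through the Hodge operator `Θ`).

SETTING.  A Lie algebra `𝔤` over a field `K` of characteristic `0`; two `K`-linear maps `ρ_i : 𝔤 → End(U_i)` compatible with brackets
(`ρ_i ⁅X, Y⁆ = ρ_i X ρ_i Y − ρ_i Y ρ_i X`); a GRADING ELEMENT `D ∈ 𝔤` acting on BOTH sides as `ρ_i D = a + c · ℓ_i ⊗ f_i` with the SAME scalars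
`a` and `c ≠ 0`, where `ℓ_i ∈ U_i`, `f_i ∈ U_i^*`, `f_i(ℓ_i) = 1` — so `E_i = ℓ_i ⊗ f_i` (`LinearMap.smulRight f_i ℓ_i`) is the rank-one idempotent onto
the LINE `Kℓ_i` along `P_i = ker f_i`, and `ad D` grades `End(U_i) = Hom(L_i,P_i) ⊕ (End P_i ⊕ End L_i) ⊕ Hom(P_i,L_i)` (raising / diagonal /
lowering) with the weights `−c, 0, c`.  HYPOTHESIS (K): the two kernels see only scalars — `ρ₁ X = 0 ⟹ ρ₂ X ∈ K·1` and `ρ₂ X = 0 ⟹ ρ₁ X ∈ K·1`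
(for `𝔤 ⊆ 𝔤₁ ⊕ 𝔤₂` a Goursat position whose two kernel ideals are central).  HYPOTHESIS (R) (only for the intertwiner): the raising root space of
side `1` is full — every rank-one operator `u ↦ f₁(u) y`, `y ∈ P₁`, is a `ρ₁ X`.

RESULTS.
* §1 `rho_ad`, **`rho_up`**, **`rho_lo`** — the raising / lowering components of `ρ_i Z` are the images of the ELEMENTS
  `Z^± = (ad_D² Z ∓ c·ad_D Z)/2c² ∈ 𝔤`; `raise_apply`, `lower_apply`, **`double_bracket_eq`** (`[[R, Y], R] = 2 f(YRℓ)·R` for raising `R`,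
  lowering `Y`: `R² = 0`, `YR ∈ K·E`), `apply_commutator_apply` (the `ℓ`-entry of a commutator only sees the lowering-times-raising corners).
* §2 **`pairing_eq`** — under (K): `f₁(ρ₁Y ρ₁X ℓ₁) = f₂(ρ₂Y ρ₂X ℓ₂)` for `X` raising and `Y` lowering on both sides (apply `ρ₂` to
  `⁅⁅X,Y⁆,X⁆ − 2f₁(ρ₁Yρ₁Xℓ₁)·X ∈ ker ρ₁`: a raising operator which is a scalar is `0`); **`apply_lie_eq`** — the `ℓ`-ENTRIES OF EVERY BRACKET AGREE:
  `f₁(ρ₁⁅X,Y⁆ℓ₁) = f₂(ρ₂⁅X,Y⁆ℓ₂)` for all `X, Y ∈ 𝔤`.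
* §3 **`exists_intertwiner`** — under (K) and (R) there is a linear `S : U₁ → U₂` with `S ℓ₁ = ℓ₂` (so `S ≠ 0`) and `ρ₂ Z ∘ S = S ∘ ρ₁ Z` for
  every `Z ∈ 𝔤` whose `ℓ`-entries agree, `f₁(ρ₁Zℓ₁) = f₂(ρ₂Zℓ₂)`; **`exists_intertwiner_lie`** — in particular `S` intertwines every bracket
  `⁅X, Y⁆` (the DERIVED ALGEBRA) and `D` itself.  CONSTRUCTION: `Φ_i(X) = ρ_i(X⁺)ℓ_i`; `ker Φ₁ ≤ ker Φ₂` by (K); `range Φ₁ = P₁` by (R);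
  `S = Φ₂ ∘ Φ₁⁻¹` on `P₁`, `S ℓ₁ = ℓ₂`; then `ρ_i Z ℓ_i = Φ_i Z + f_i(ρ_iZℓ_i)ℓ_i` and `ρ_i Z Φ_i X = Φ_i⁅Z,X⁺⁆ + f_i(ρ_i⁅Z,X⁺⁆ℓ_i)ℓ_i +
  f_i(ρ_iZℓ_i)Φ_i X`, so both sides agree by `apply_lie_eq` and the hypothesis on `Z`.
No irreducibility, no highest-weight theory and no Schur lemma is used; the grading element replaces them.

USE (`Motives/HodgeLieUnitaryPairGraph`, `CorCM/MumfordTateRankTypeIVThreefoldPairsExact`): `𝔤 = 𝔥(H¹T ⊕ H¹T′) ⊗ ℂ`, `U_i = W_i =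
ker(φ_{i,ℂ} − μ_i)` the `(2,1)`-eigenspaces of the imaginary quadratic multiplications, `D = Θ` (`a = 1`, `c = −2`, `ℓ_i` spanning `W_i ∩ H^{0,1}`;
the `ℓ`-entries of `Θ` are both `−1`), (R) from the raising operators of `Motives/HodgeThetaSubalgebraUnitary` §5, (K) from the simplicity of the
eight-dimensional derived algebras; the intertwiner descends to a non-zero Hodge morphism `H¹T → H¹T′`.

## References
* [MoonenZarhin1999LowDim] B. Moonen, Yu. G. Zarhin, *Hodge classes on abelian varieties of low dimension*, Math. Ann. 315 (1999) 711–733,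
  §3 (3.1) and Lemma (3.4) (Goursat graphs between Hodge Lie algebras come from isogenies) [corpus: paper:arxiv-math_9901113 p. 6].
  [cite: MoonenZarhin1999LowDim, §3 (3.1) and Lemma (3.4)]
* [Hazama1983] F. Hazama, *Algebraic cycles on abelian varieties with many real endomorphisms*, Tôhoku Math. J. 35 (1983), Lemma (3.1)
  (Goursat's lemma for Lie algebras). [cite: Hazama1983, Lemma (3.1)]
* [Humphreys1972] J. E. Humphreys, *Introduction to Lie Algebras and Representation Theory*, GTM 9 (1972), §8.1 (decomposition under `ad` of a
  semisimple element), §20.2 (a module generated from one weight vector by lowering / raising operators). [cite: Humphreys1972, §8.1]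
* [GoodmanWallachGTM255] R. Goodman, N. Wallach, *Symmetry, Representations, and Invariants*, GTM 255, §4.1.1 (rank-one operators,
  commutants). [cite: GoodmanWallachGTM255, §4.1.1]
-/

namespace Literature.Algebra.Lie

namespace LineGradedIntertwiner

open Module

variable {K : Type*} [Field K] [CharZero K] {𝔤 : Type*} [LieRing 𝔤] [LieAlgebra K 𝔤]

/-! ### §1 One representation: the rank-one idempotent `E = ℓ ⊗ f`, the grading by `ad D`, raising and lowering operators -/

section One

variable {U : Type*} [AddCommGroup U] [Module K U] (ρ : 𝔤 →ₗ[K] Module.End K U)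
  (hbr : ∀ X Y : 𝔤, ρ ⁅X, Y⁆ = ρ X * ρ Y - ρ Y * ρ X) {D : 𝔤} {a c : K} {ℓ : U} {f : Module.Dual K U} (hfℓ : f ℓ = 1)
  (hD : ∀ u, ρ D u = a • u + c • f u • ℓ)

omit [CharZero K] [LieRing 𝔤] [LieAlgebra K 𝔤] in
include hfℓ in
/-- `E = ℓ ⊗ f` is idempotent (`f(ℓ) = 1`). [cite: GoodmanWallachGTM255, §4.1.1] -/
theorem smulRight_mul_smulRight : f.smulRight ℓ * f.smulRight ℓ = f.smulRight ℓ := by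
  refine LinearMap.ext fun u => ?_
  simp only [Module.End.mul_apply, LinearMap.smulRight_apply, map_smul, hfℓ, one_smul]

omit [CharZero K] in
include hbr hD in
/-- `ρ ⁅D, Z⁆ = c (E ρZ − ρZ E)` for the grading element `ρ D = a + c E`. [cite: Humphreys1972, §8.1] -/
theorem rho_ad (Z : 𝔤) : ρ ⁅D, Z⁆ = c • (f.smulRight ℓ * ρ Z - ρ Z * f.smulRight ℓ) := by
  rw [hbr]
  refine LinearMap.ext fun u => ?_
  simp only [Module.End.mul_apply, LinearMap.sub_apply, LinearMap.smul_apply, LinearMap.smulRight_apply, hD, map_add, map_smul]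
  module

include hbr hfℓ hD in
/-- **The RAISING component is cut out inside `𝔤`**: `ρ((ad_D² Z − c·ad_D Z)/2c²) = (1 − E) ρZ E` (`ad D` has the weights `−c, 0, c` on
`Hom(L,P)`, `End P ⊕ End L`, `Hom(P,L)`). [cite: Humphreys1972, §8.1] -/
theorem rho_up (hc : c ≠ 0) (Z : 𝔤) :
    ρ ((2 * c ^ 2)⁻¹ • (⁅D, ⁅D, Z⁆⁆ - c • ⁅D, Z⁆)) = (1 - f.smulRight ℓ) * ρ Z * f.smulRight ℓ := by
  have h : ρ (⁅D, ⁅D, Z⁆⁆ - c • ⁅D, Z⁆) = (2 * c ^ 2) • ((1 - f.smulRight ℓ) * ρ Z * f.smulRight ℓ) := by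
    rw [map_sub, map_smul, rho_ad ρ hbr hD, rho_ad ρ hbr hD]
    refine LinearMap.ext fun u => ?_
    simp only [Module.End.mul_apply, LinearMap.sub_apply, LinearMap.smul_apply, LinearMap.smulRight_apply, Module.End.one_apply,
      map_sub, map_smul, hfℓ]
    module
  rw [map_smul, h, smul_smul, inv_mul_cancel₀ (mul_ne_zero two_ne_zero (pow_ne_zero 2 hc)), one_smul]

include hbr hfℓ hD in
/-- **The LOWERING component**: `ρ((ad_D² Z + c·ad_D Z)/2c²) = E ρZ (1 − E)`. [cite: Humphreys1972, §8.1] -/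
theorem rho_lo (hc : c ≠ 0) (Z : 𝔤) :
    ρ ((2 * c ^ 2)⁻¹ • (⁅D, ⁅D, Z⁆⁆ + c • ⁅D, Z⁆)) = f.smulRight ℓ * ρ Z * (1 - f.smulRight ℓ) := by
  have h : ρ (⁅D, ⁅D, Z⁆⁆ + c • ⁅D, Z⁆) = (2 * c ^ 2) • (f.smulRight ℓ * ρ Z * (1 - f.smulRight ℓ)) := by
    rw [map_add, map_smul, rho_ad ρ hbr hD, rho_ad ρ hbr hD]
    refine LinearMap.ext fun u => ?_
    simp only [Module.End.mul_apply, LinearMap.sub_apply, LinearMap.add_apply, LinearMap.smul_apply, LinearMap.smulRight_apply,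
      Module.End.one_apply, map_sub, map_smul, hfℓ]
    module
  rw [map_smul, h, smul_smul, inv_mul_cancel₀ (mul_ne_zero two_ne_zero (pow_ne_zero 2 hc)), one_smul]

omit [CharZero K] [LieRing 𝔤] [LieAlgebra K 𝔤] in
include hfℓ in
/-- A RAISING operator `R = (1 − E) R E` is the rank-one map `u ↦ f(u) Rℓ` with `f(Rℓ) = 0`. [cite: Humphreys1972, §8.1] -/
theorem raise_apply {R : Module.End K U} (hR : R = (1 - f.smulRight ℓ) * R * f.smulRight ℓ) (u : U) :
    R u = f u • R ℓ ∧ f (R ℓ) = 0 := by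
  have h1 : ∀ v, R v = f v • R ℓ - (f v * f (R ℓ)) • ℓ := fun v => by
    conv_lhs => rw [hR]
    simp only [Module.End.mul_apply, LinearMap.sub_apply, Module.End.one_apply, LinearMap.smulRight_apply, map_smul]
    module
  have h2 : f (R ℓ) = 0 := by
    have h := congrArg f (h1 ℓ)
    rw [hfℓ, one_smul, one_mul, map_sub, map_smul, hfℓ, smul_eq_mul, mul_one, sub_self] at h
    exact h
  refine ⟨?_, h2⟩
  rw [h1 u, h2, mul_zero, zero_smul, sub_zero]

omit [CharZero K] [LieRing 𝔤] [LieAlgebra K 𝔤] in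
include hfℓ in
/-- A LOWERING operator `Y = E Y (1 − E)` kills `ℓ` and takes values on the line: `Y u = f(Y u) ℓ`. [cite: Humphreys1972, §8.1] -/
theorem lower_apply {Y : Module.End K U} (hY : Y = f.smulRight ℓ * Y * (1 - f.smulRight ℓ)) (u : U) :
    Y u = f (Y u) • ℓ ∧ Y ℓ = 0 := by
  have h1 : ∀ v, Y v = (f (Y v) - f v * f (Y ℓ)) • ℓ := fun v => by
    conv_lhs => rw [hY]
    simp only [Module.End.mul_apply, LinearMap.sub_apply, Module.End.one_apply, LinearMap.smulRight_apply, map_sub, map_smul]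
    module
  have h2 : Y ℓ = 0 := by
    rw [h1 ℓ, hfℓ, one_mul, sub_self, zero_smul]
  refine ⟨?_, h2⟩
  conv_lhs => rw [h1 u, h2, map_zero, mul_zero, sub_zero]

omit [CharZero K] [LieRing 𝔤] [LieAlgebra K 𝔤] in
include hfℓ in
/-- **The double bracket of a raising `R` and a lowering `Y`**: `[[R, Y], R] = 2 f(Y R ℓ) · R` (`R² = 0`, `Y R = f(YRℓ) E`, `R E = R`).
[cite: Humphreys1972, §8.1] [cite: GoodmanWallachGTM255, §4.1.1] -/
theorem double_bracket_eq {R Y : Module.End K U} (hR : R = (1 - f.smulRight ℓ) * R * f.smulRight ℓ)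
    (hY : Y = f.smulRight ℓ * Y * (1 - f.smulRight ℓ)) :
    (R * Y - Y * R) * R - R * (R * Y - Y * R) = (2 * f (Y (R ℓ))) • R := by
  set r := R ℓ with hr
  have hRu : ∀ v, R v = f v • r := fun v => (raise_apply hfℓ hR v).1
  have hfr : f r = 0 := (raise_apply hfℓ hR ℓ).2
  set g : Module.Dual K U := f ∘ₗ Y with hg
  have hYu : ∀ v, Y v = g v • ℓ := fun v => (lower_apply hfℓ hY v).1
  refine LinearMap.ext fun u => ?_
  simp only [LinearMap.sub_apply, Module.End.mul_apply, LinearMap.smul_apply, hRu, hYu, map_smul, map_sub, map_zero, zero_smul,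
    hfℓ, hfr]
  module

omit [CharZero K] [LieRing 𝔤] [LieAlgebra K 𝔤] in
include hfℓ in
/-- **The `ℓ`-entry of a commutator**: `f([T, T′] ℓ) = f(T⁻ T′⁺ ℓ) − f(T′⁻ T⁺ ℓ)` with `T⁺ = (1−E)TE`, `T⁻ = ET(1−E)` — only the
lowering-times-raising corners contribute. [cite: Humphreys1972, §8.1] -/
theorem apply_commutator_apply (T T' : Module.End K U) :
    f ((T * T' - T' * T) ℓ) =
      f ((f.smulRight ℓ * T * (1 - f.smulRight ℓ)) (((1 - f.smulRight ℓ) * T' * f.smulRight ℓ) ℓ)) -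
        f ((f.smulRight ℓ * T' * (1 - f.smulRight ℓ)) (((1 - f.smulRight ℓ) * T * f.smulRight ℓ) ℓ)) := by
  simp only [LinearMap.sub_apply, Module.End.mul_apply, Module.End.one_apply, LinearMap.smulRight_apply, map_sub, map_smul, hfℓ,
    smul_eq_mul, mul_one, one_smul]
  ring

omit [CharZero K] [LieRing 𝔤] [LieAlgebra K 𝔤] in
include hfℓ in
/-- `(T⁺)⁺ = T⁺`. [cite: Humphreys1972, §8.1] -/
theorem up_up (T : Module.End K U) :
    (1 - f.smulRight ℓ) * ((1 - f.smulRight ℓ) * T * f.smulRight ℓ) * f.smulRight ℓ = (1 - f.smulRight ℓ) * T * f.smulRight ℓ := by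
  have hEE := smulRight_mul_smulRight (ℓ := ℓ) (f := f) hfℓ
  have h1 : (1 - f.smulRight ℓ) * (1 - f.smulRight ℓ) = 1 - f.smulRight ℓ := by
    rw [mul_sub, mul_one, sub_mul, one_mul, hEE, sub_self, sub_zero]
  rw [← mul_assoc, ← mul_assoc, h1, mul_assoc _ (f.smulRight ℓ) (f.smulRight ℓ), hEE]

omit [CharZero K] [LieRing 𝔤] [LieAlgebra K 𝔤] in
include hfℓ in
/-- `(T⁻)⁻ = T⁻`. [cite: Humphreys1972, §8.1] -/
theorem lo_lo (T : Module.End K U) :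
    f.smulRight ℓ * (f.smulRight ℓ * T * (1 - f.smulRight ℓ)) * (1 - f.smulRight ℓ) = f.smulRight ℓ * T * (1 - f.smulRight ℓ) := by
  have hEE := smulRight_mul_smulRight (ℓ := ℓ) (f := f) hfℓ
  have h1 : (1 - f.smulRight ℓ) * (1 - f.smulRight ℓ) = 1 - f.smulRight ℓ := by
    rw [mul_sub, mul_one, sub_mul, one_mul, hEE, sub_self, sub_zero]
  rw [← mul_assoc, ← mul_assoc, hEE, mul_assoc _ (1 - f.smulRight ℓ) (1 - f.smulRight ℓ), h1]

end One

/-! ### §2 Two representations: the pairing identity and the intertwiner -/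

section Two

variable {U₁ : Type*} [AddCommGroup U₁] [Module K U₁] {U₂ : Type*} [AddCommGroup U₂] [Module K U₂]
  (ρ₁ : 𝔤 →ₗ[K] Module.End K U₁) (ρ₂ : 𝔤 →ₗ[K] Module.End K U₂)
  (hbr₁ : ∀ X Y : 𝔤, ρ₁ ⁅X, Y⁆ = ρ₁ X * ρ₁ Y - ρ₁ Y * ρ₁ X) (hbr₂ : ∀ X Y : 𝔤, ρ₂ ⁅X, Y⁆ = ρ₂ X * ρ₂ Y - ρ₂ Y * ρ₂ X)
  {D : 𝔤} {a c : K} (hc : c ≠ 0)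
  {ℓ₁ : U₁} {f₁ : Module.Dual K U₁} (hfℓ₁ : f₁ ℓ₁ = 1) (hD₁ : ∀ u, ρ₁ D u = a • u + c • f₁ u • ℓ₁)
  {ℓ₂ : U₂} {f₂ : Module.Dual K U₂} (hfℓ₂ : f₂ ℓ₂ = 1) (hD₂ : ∀ u, ρ₂ D u = a • u + c • f₂ u • ℓ₂)
  (hK₁₂ : ∀ X : 𝔤, ρ₁ X = 0 → ∃ k : K, ρ₂ X = k • 1) (hK₂₁ : ∀ X : 𝔤, ρ₂ X = 0 → ∃ k : K, ρ₁ X = k • 1)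

omit [CharZero K] [LieRing 𝔤] [LieAlgebra K 𝔤] in
/-- A raising operator which is a scalar vanishes (`f(Rℓ) = 0` reads `k = 0`). [cite: Humphreys1972, §8.1] -/
theorem eq_zero_of_raise_of_smul {U : Type*} [AddCommGroup U] [Module K U] {ℓ : U} {f : Module.Dual K U} (hfℓ : f ℓ = 1)
    {R : Module.End K U} (hR : R = (1 - f.smulRight ℓ) * R * f.smulRight ℓ) {k : K} (hk : R = k • 1) : R = 0 := by
  have hfR := (raise_apply hfℓ hR ℓ).2
  rw [hk, LinearMap.smul_apply, Module.End.one_apply, map_smul, hfℓ, smul_eq_mul, mul_one] at hfR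
  rw [hk, hfR, zero_smul]

include hbr₁ hbr₂ hfℓ₁ hfℓ₂ hK₁₂ hK₂₁ in
/-- **The pairing identity.**  For `X, Y ∈ 𝔤` with `ρ_i X` raising and `ρ_i Y` lowering on both sides, the `ℓ`-entries of `ρ₁Y ρ₁X` and
`ρ₂Y ρ₂X` agree: `f₁(ρ₁Y ρ₁X ℓ₁) = f₂(ρ₂Y ρ₂X ℓ₂)` — apply `ρ₂` to `⁅⁅X,Y⁆,X⁆ − 2f₁(ρ₁Yρ₁Xℓ₁)·X ∈ ker ρ₁` (a scalar raising operator is `0`);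
if `ρ₂ X = 0` both sides vanish. [cite: MoonenZarhin1999LowDim, §3 (3.1) and Lemma (3.4)] [cite: Humphreys1972, §8.1] -/
theorem pairing_eq {X Y : 𝔤} (hX₁ : ρ₁ X = (1 - f₁.smulRight ℓ₁) * ρ₁ X * f₁.smulRight ℓ₁)
    (hX₂ : ρ₂ X = (1 - f₂.smulRight ℓ₂) * ρ₂ X * f₂.smulRight ℓ₂) (hY₁ : ρ₁ Y = f₁.smulRight ℓ₁ * ρ₁ Y * (1 - f₁.smulRight ℓ₁))
    (hY₂ : ρ₂ Y = f₂.smulRight ℓ₂ * ρ₂ Y * (1 - f₂.smulRight ℓ₂)) :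
    f₁ (ρ₁ Y (ρ₁ X ℓ₁)) = f₂ (ρ₂ Y (ρ₂ X ℓ₂)) := by
  set B : 𝔤 := ⁅⁅X, Y⁆, X⁆ - (2 * f₁ (ρ₁ Y (ρ₁ X ℓ₁))) • X with hB
  have hB₁ : ρ₁ B = 0 := by
    rw [hB, map_sub, map_smul, hbr₁, hbr₁, double_bracket_eq hfℓ₁ hX₁ hY₁, sub_self]
  have hB₂ : ρ₂ B = (2 * f₂ (ρ₂ Y (ρ₂ X ℓ₂)) - 2 * f₁ (ρ₁ Y (ρ₁ X ℓ₁))) • ρ₂ X := by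
    rw [hB, map_sub, map_smul, hbr₂, hbr₂, double_bracket_eq hfℓ₂ hX₂ hY₂, sub_smul]
  obtain ⟨k, hk⟩ := hK₁₂ B hB₁
  by_cases hX0 : ρ₂ X = 0
  · -- then `ρ₁ X` is a scalar raising operator, hence `0`
    obtain ⟨k', hk'⟩ := hK₂₁ X hX0
    have h1 : ρ₁ X = 0 := eq_zero_of_raise_of_smul hfℓ₁ hX₁ hk'
    rw [h1, hX0, LinearMap.zero_apply, map_zero, map_zero, LinearMap.zero_apply, map_zero, map_zero]
  · -- `(2f₂ − 2f₁) ρ₂X` is raising and a scalar, hence `0`; `ρ₂ X ≠ 0`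
    have hR : ρ₂ B = (1 - f₂.smulRight ℓ₂) * ρ₂ B * f₂.smulRight ℓ₂ := by
      rw [hB₂, mul_smul_comm, smul_mul_assoc, ← hX₂]
    have h0 := eq_zero_of_raise_of_smul hfℓ₂ hR hk
    rw [hB₂] at h0
    rcases smul_eq_zero.1 h0 with h | h
    · have h' : f₂ (ρ₂ Y (ρ₂ X ℓ₂)) - f₁ (ρ₁ Y (ρ₁ X ℓ₁)) = 0 := by
        have : (2 : K) * (f₂ (ρ₂ Y (ρ₂ X ℓ₂)) - f₁ (ρ₁ Y (ρ₁ X ℓ₁))) = 0 := by rw [mul_sub]; exact h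
        exact (mul_eq_zero.1 this).resolve_left two_ne_zero
      exact (sub_eq_zero.1 h').symm
    · exact absurd h hX0

include hbr₁ hbr₂ hc hfℓ₁ hD₁ hfℓ₂ hD₂ hK₁₂ hK₂₁ in
/-- **The `ℓ`-entries of a bracket agree on the two sides**: `f₁(ρ₁⁅X,Y⁆ ℓ₁) = f₂(ρ₂⁅X,Y⁆ ℓ₂)` for all `X, Y ∈ 𝔤`.  Only the lowering-times-raising
corners contribute to the `ℓ`-entry of a commutator, and those are governed by the pairing identity applied to the graded components
`X⁺ = (ad_D² X − c ad_D X)/2c²`, `Y⁻ = (ad_D² Y + c ad_D Y)/2c²` (elements of `𝔤`). [cite: MoonenZarhin1999LowDim, §3 (3.1) and Lemma (3.4)]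
[cite: Humphreys1972, §8.1] -/
theorem apply_lie_eq (X Y : 𝔤) : f₁ (ρ₁ ⁅X, Y⁆ ℓ₁) = f₂ (ρ₂ ⁅X, Y⁆ ℓ₂) := by
  have hup₁ := rho_up ρ₁ hbr₁ hfℓ₁ hD₁ hc
  have hup₂ := rho_up ρ₂ hbr₂ hfℓ₂ hD₂ hc
  have hlo₁ := rho_lo ρ₁ hbr₁ hfℓ₁ hD₁ hc
  have hlo₂ := rho_lo ρ₂ hbr₂ hfℓ₂ hD₂ hc
  have hpair := fun X' Y' => pairing_eq ρ₁ ρ₂ hbr₁ hbr₂ hfℓ₁ hfℓ₂ hK₁₂ hK₂₁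
    (X := (2 * c ^ 2)⁻¹ • (⁅D, ⁅D, X'⁆⁆ - c • ⁅D, X'⁆)) (Y := (2 * c ^ 2)⁻¹ • (⁅D, ⁅D, Y'⁆⁆ + c • ⁅D, Y'⁆))
    (by rw [hup₁, up_up hfℓ₁]) (by rw [hup₂, up_up hfℓ₂]) (by rw [hlo₁, lo_lo hfℓ₁]) (by rw [hlo₂, lo_lo hfℓ₂])
  have h1 := hpair Y X
  have h2 := hpair X Y
  rw [hup₁, hup₂, hlo₁, hlo₂] at h1 h2
  rw [hbr₁, hbr₂, apply_commutator_apply hfℓ₁, apply_commutator_apply hfℓ₂, h1, h2]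


/-! ### §3 The intertwiner -/

include hbr₁ hbr₂ hc hfℓ₁ hD₁ hfℓ₂ hD₂ hK₁₂ hK₂₁ in
/-- **The line-graded recognition lemma.**  Under the full raising root space on side `1` (`hraise`: every `u ↦ f₁(u) y`, `f₁(y) = 0`, is a
`ρ₁ X`), there is a linear `S : U₁ → U₂` with `S ℓ₁ = ℓ₂` intertwining every `Z ∈ 𝔤` whose `ℓ`-entries agree (`f₁(ρ₁Zℓ₁) = f₂(ρ₂Zℓ₂)`).
CONSTRUCTION: `Φ_i(X) = ρ_i(X⁺) ℓ_i` (`X⁺` the raising component); `ker Φ₁ ≤ ker Φ₂` (a raising operator vanishing at `ℓ₁` is `0`, then `ρ₂(X⁺)` is a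
raising scalar, i.e. `0`), `range Φ₁ = ker f₁` (`hraise`), so `S := Φ₂ ∘ Φ₁⁻¹` on `ker f₁` and `S ℓ₁ := ℓ₂`.  VERIFICATION on `ℓ₁` and on `Φ₁ X`:
`ρ_i Z ℓ_i = Φ_i Z + f_i(ρ_iZℓ_i) ℓ_i` and `ρ_i Z (Φ_i X) = Φ_i⁅Z, X⁺⁆ + f_i(ρ_i⁅Z,X⁺⁆ℓ_i) ℓ_i + f_i(ρ_iZℓ_i) Φ_i X`, where the bracket entries
agree by `apply_lie_eq`. [cite: MoonenZarhin1999LowDim, §3 (3.1) and Lemma (3.4)] [cite: Humphreys1972, §20.2] -/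
theorem exists_intertwiner (hraise : ∀ y : U₁, f₁ y = 0 → ∃ X : 𝔤, ∀ u, ρ₁ X u = f₁ u • y) :
    ∃ S : U₁ →ₗ[K] U₂, S ℓ₁ = ℓ₂ ∧ ∀ Z : 𝔤, f₁ (ρ₁ Z ℓ₁) = f₂ (ρ₂ Z ℓ₂) → ρ₂ Z ∘ₗ S = S ∘ₗ ρ₁ Z := by
  classical
  -- the raising component as a linear map on `𝔤`
  set up : Module.End K 𝔤 := (2 * c ^ 2)⁻¹ • (LieAlgebra.ad K 𝔤 D * LieAlgebra.ad K 𝔤 D - c • LieAlgebra.ad K 𝔤 D) with hupdef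
  have hupZ : ∀ Z, up Z = (2 * c ^ 2)⁻¹ • (⁅D, ⁅D, Z⁆⁆ - c • ⁅D, Z⁆) := fun Z => by
    simp only [hupdef, LinearMap.smul_apply, LinearMap.sub_apply, Module.End.mul_apply, LieAlgebra.ad_apply]
  have hup₁ : ∀ Z, ρ₁ (up Z) = (1 - f₁.smulRight ℓ₁) * ρ₁ Z * f₁.smulRight ℓ₁ := fun Z => by
    rw [hupZ]; exact rho_up ρ₁ hbr₁ hfℓ₁ hD₁ hc Z
  have hup₂ : ∀ Z, ρ₂ (up Z) = (1 - f₂.smulRight ℓ₂) * ρ₂ Z * f₂.smulRight ℓ₂ := fun Z => by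
    rw [hupZ]; exact rho_up ρ₂ hbr₂ hfℓ₂ hD₂ hc Z
  have hR₁ : ∀ X, ρ₁ (up X) = (1 - f₁.smulRight ℓ₁) * ρ₁ (up X) * f₁.smulRight ℓ₁ := fun X => by rw [hup₁, up_up hfℓ₁]
  have hR₂ : ∀ X, ρ₂ (up X) = (1 - f₂.smulRight ℓ₂) * ρ₂ (up X) * f₂.smulRight ℓ₂ := fun X => by rw [hup₂, up_up hfℓ₂]
  -- `Φ_i X = ρ_i(X⁺) ℓ_i`
  set Φ : 𝔤 →ₗ[K] U₁ := LinearMap.applyₗ ℓ₁ ∘ₗ (ρ₁ ∘ₗ up) with hΦdef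
  set Ψ : 𝔤 →ₗ[K] U₂ := LinearMap.applyₗ ℓ₂ ∘ₗ (ρ₂ ∘ₗ up) with hΨdef
  have hΦ : ∀ X, Φ X = ρ₁ (up X) ℓ₁ := fun X => rfl
  have hΨ : ∀ X, Ψ X = ρ₂ (up X) ℓ₂ := fun X => rfl
  have hΦraise : ∀ X u, ρ₁ (up X) u = f₁ u • Φ X := fun X u => by rw [hΦ]; exact (raise_apply hfℓ₁ (hR₁ X) u).1
  have hΨraise : ∀ X u, ρ₂ (up X) u = f₂ u • Ψ X := fun X u => by rw [hΨ]; exact (raise_apply hfℓ₂ (hR₂ X) u).1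
  have hfΦ : ∀ X, f₁ (Φ X) = 0 := fun X => by rw [hΦ]; exact (raise_apply hfℓ₁ (hR₁ X) ℓ₁).2
  have hfΨ : ∀ X, f₂ (Ψ X) = 0 := fun X => by rw [hΨ]; exact (raise_apply hfℓ₂ (hR₂ X) ℓ₂).2
  -- the `ℓ`-decomposition `ρ_i Z ℓ_i = Φ_i Z + f_i(ρ_i Z ℓ_i) ℓ_i`
  have hdec₁ : ∀ Z, ρ₁ Z ℓ₁ = Φ Z + f₁ (ρ₁ Z ℓ₁) • ℓ₁ := fun Z => by
    rw [hΦ, hup₁]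
    simp only [Module.End.mul_apply, LinearMap.sub_apply, Module.End.one_apply, LinearMap.smulRight_apply, hfℓ₁, one_smul]
    abel
  have hdec₂ : ∀ Z, ρ₂ Z ℓ₂ = Ψ Z + f₂ (ρ₂ Z ℓ₂) • ℓ₂ := fun Z => by
    rw [hΨ, hup₂]
    simp only [Module.End.mul_apply, LinearMap.sub_apply, Module.End.one_apply, LinearMap.smulRight_apply, hfℓ₂, one_smul]
    abel
  -- `ker Φ ≤ ker Ψ`
  have hker : LinearMap.ker Φ ≤ LinearMap.ker Ψ := by
    intro X hX
    rw [LinearMap.mem_ker] at hX ⊢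
    have h0 : ρ₁ (up X) = 0 := by
      refine LinearMap.ext fun u => ?_
      rw [hΦraise, hX, smul_zero, LinearMap.zero_apply]
    obtain ⟨k, hk⟩ := hK₁₂ _ h0
    rw [hΨ, eq_zero_of_raise_of_smul hfℓ₂ (hR₂ X) hk, LinearMap.zero_apply]
  -- `range Φ = ker f₁`
  have hrange : LinearMap.range Φ = LinearMap.ker f₁ := by
    apply le_antisymm
    · rintro _ ⟨X, rfl⟩
      exact hfΦ X
    · intro y hy
      rw [LinearMap.mem_ker] at hy
      obtain ⟨X, hX⟩ := hraise y hy
      refine ⟨X, ?_⟩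
      rw [hΦ, hup₁]
      simp only [Module.End.mul_apply, LinearMap.sub_apply, Module.End.one_apply, LinearMap.smulRight_apply, hfℓ₁, one_smul, hX, hy,
        zero_smul, sub_zero]
  -- `S = Ψ ∘ Φ⁻¹` on `range Φ`, `S ℓ₁ = ℓ₂`
  set SP : LinearMap.range Φ →ₗ[K] U₂ :=
    (LinearMap.ker Φ).liftQ Ψ hker ∘ₗ (LinearMap.quotKerEquivRange Φ).symm.toLinearMap with hSPdef
  have hSP : ∀ X (h : Φ X ∈ LinearMap.range Φ), SP ⟨Φ X, h⟩ = Ψ X := fun X h => by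
    rw [hSPdef, LinearMap.comp_apply, LinearEquiv.coe_toLinearMap, LinearMap.quotKerEquivRange_symm_apply_image,
      Submodule.mkQ_apply, Submodule.liftQ_apply]
  have hpr : ∀ u, u - f₁ u • ℓ₁ ∈ LinearMap.range Φ := fun u => by
    rw [hrange, LinearMap.mem_ker, map_sub, map_smul, hfℓ₁, smul_eq_mul, mul_one, sub_self]
  set pr : U₁ →ₗ[K] LinearMap.range Φ := LinearMap.codRestrict (LinearMap.range Φ) (1 - f₁.smulRight ℓ₁) (fun u => by
    rw [LinearMap.sub_apply, Module.End.one_apply, LinearMap.smulRight_apply]; exact hpr u) with hprdef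
  set S : U₁ →ₗ[K] U₂ := SP ∘ₗ pr + f₁.smulRight ℓ₂ with hSdef
  have hSapply : ∀ u, S u = SP (pr u) + f₁ u • ℓ₂ := fun u => rfl
  have hSℓ : S ℓ₁ = ℓ₂ := by
    have h : pr ℓ₁ = 0 := Subtype.ext (by
      rw [hprdef, LinearMap.codRestrict_apply, LinearMap.sub_apply, Module.End.one_apply, LinearMap.smulRight_apply, hfℓ₁, one_smul,
        sub_self]; rfl)
    rw [hSapply, h, map_zero, zero_add, hfℓ₁, one_smul]
  have hSΦ : ∀ X, S (Φ X) = Ψ X := fun X => by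
    have h : pr (Φ X) = ⟨Φ X, LinearMap.mem_range_self Φ X⟩ := Subtype.ext (by
      rw [hprdef, LinearMap.codRestrict_apply, LinearMap.sub_apply, Module.End.one_apply, LinearMap.smulRight_apply, hfΦ, zero_smul,
        sub_zero])
    rw [hSapply, h, hSP, hfΦ, zero_smul, add_zero]
  refine ⟨S, hSℓ, fun Z hZ => ?_⟩
  -- on `ℓ₁`
  have hℓ : ρ₂ Z (S ℓ₁) = S (ρ₁ Z ℓ₁) := by
    rw [hSℓ, hdec₂, hdec₁, map_add, map_smul, hSΦ, hSℓ, hZ]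
  -- on `Φ X`
  have hP : ∀ X, ρ₂ Z (S (Φ X)) = S (ρ₁ Z (Φ X)) := by
    intro X
    have hγ := apply_lie_eq ρ₁ ρ₂ hbr₁ hbr₂ hc hfℓ₁ hD₁ hfℓ₂ hD₂ hK₁₂ hK₂₁ Z (up X)
    have h1 : ρ₁ Z (Φ X) = Φ ⁅Z, up X⁆ + f₁ (ρ₁ ⁅Z, up X⁆ ℓ₁) • ℓ₁ + f₁ (ρ₁ Z ℓ₁) • Φ X := by
      rw [hΦ X, ← Module.End.mul_apply, show ρ₁ Z * ρ₁ (up X) = ρ₁ ⁅Z, up X⁆ + ρ₁ (up X) * ρ₁ Z by rw [hbr₁, sub_add_cancel],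
        LinearMap.add_apply, Module.End.mul_apply, hΦraise X (ρ₁ Z ℓ₁), ← hdec₁, ← hΦ]
    have h2 : ρ₂ Z (Ψ X) = Ψ ⁅Z, up X⁆ + f₂ (ρ₂ ⁅Z, up X⁆ ℓ₂) • ℓ₂ + f₂ (ρ₂ Z ℓ₂) • Ψ X := by
      rw [hΨ X, ← Module.End.mul_apply, show ρ₂ Z * ρ₂ (up X) = ρ₂ ⁅Z, up X⁆ + ρ₂ (up X) * ρ₂ Z by rw [hbr₂, sub_add_cancel],
        LinearMap.add_apply, Module.End.mul_apply, hΨraise X (ρ₂ Z ℓ₂), ← hdec₂, ← hΨ]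
    rw [hSΦ, h2, h1, map_add, map_add, map_smul, map_smul, hSΦ, hSΦ, hSℓ, hγ, hZ]
  -- every `u` is `Φ X + f₁(u) ℓ₁`
  refine LinearMap.ext fun u => ?_
  obtain ⟨X, hX⟩ : ∃ X, Φ X = u - f₁ u • ℓ₁ := hpr u
  have hu : u = Φ X + f₁ u • ℓ₁ := by rw [hX, sub_add_cancel]
  rw [LinearMap.comp_apply, LinearMap.comp_apply, hu]
  simp only [map_add, map_smul, hP, hℓ]

include hbr₁ hbr₂ hc hfℓ₁ hD₁ hfℓ₂ hD₂ hK₁₂ hK₂₁ in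
/-- **The intertwiner of the derived algebra.**  With `S` as in `exists_intertwiner`: `ρ₂⁅X,Y⁆ ∘ S = S ∘ ρ₁⁅X,Y⁆` for ALL `X, Y ∈ 𝔤`
(`apply_lie_eq`), and `ρ₂ Z ∘ S = S ∘ ρ₁ Z` for every `Z` with equal `ℓ`-entries — e.g. `Z = D` itself.  (The Goursat graph between two copies
of `𝔰𝔲(m,1) ⊗ ℂ ≅ 𝔤𝔩_{m+1}` seen through the Hodge operator comes from an isomorphism of the standard modules.)
[cite: MoonenZarhin1999LowDim, §3 (3.1) and Lemma (3.4)] [cite: Humphreys1972, §20.2] -/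
theorem exists_intertwiner_lie (hraise : ∀ y : U₁, f₁ y = 0 → ∃ X : 𝔤, ∀ u, ρ₁ X u = f₁ u • y) :
    ∃ S : U₁ →ₗ[K] U₂, S ℓ₁ = ℓ₂ ∧ (∀ X Y : 𝔤, ρ₂ ⁅X, Y⁆ ∘ₗ S = S ∘ₗ ρ₁ ⁅X, Y⁆) ∧
      ∀ Z : 𝔤, f₁ (ρ₁ Z ℓ₁) = f₂ (ρ₂ Z ℓ₂) → ρ₂ Z ∘ₗ S = S ∘ₗ ρ₁ Z := by
  obtain ⟨S, hSℓ, hS⟩ := exists_intertwiner ρ₁ ρ₂ hbr₁ hbr₂ hc hfℓ₁ hD₁ hfℓ₂ hD₂ hK₁₂ hK₂₁ hraise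
  exact ⟨S, hSℓ, fun X Y => hS _ (apply_lie_eq ρ₁ ρ₂ hbr₁ hbr₂ hc hfℓ₁ hD₁ hfℓ₂ hD₂ hK₁₂ hK₂₁ X Y), hS⟩

end Two

end LineGradedIntertwiner

end Literature.Algebra.Lie
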